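/-
Copyright (c) 2026 the pub-hodgecm-mathlib formalisation cell (harness21).  Prover seat hodgecm-mathlib-LH7-p01 (g3), 2026-09-02.  PROOF module:
THEOREMS ONLY (no definition, no named fact, no instance, no notation, no `sorry`).
-/
import Literature.NumberTheory.Automorphic.CharacterLineFinConstituents        -- ★ `isOpen_ker_comp_finAdelicToAdelic` (+ ★ `DiscreteAutomorphicRep.finRep`, ★ `inclPlaceAdelic`)
import Literature.NumberTheory.Automorphic.DiscreteAutomorphicRepFinSmoothVector  -- ★ `DiscreteAutomorphicRep.finRep_smoothPart_ne_bot` (Alaoglu–Birkhoff fixed vector)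
import Literature.NumberTheory.Automorphic.UnitaryGroupAdelicProduct            -- ★ `archToAdelic_mul_finAdelicToAdelic`, ★ `commute_archToAdelic_finAdelicToAdelic`
import Literature.Topology.Algebra.RestrictedProduct.CharacterTrivialAE         -- ★ `exists_finset_forall_mem_of_nhds_one` (neighbourhoods of `1` contain cofinite boxes)
import HarnessLib

/-!
# From the finite places to the finite adèles: if every `U(J)(F_v)` acts on the smooth vectors of a discrete automorphic `P` through a character `χ`,
# then `U(J)(𝔸_{F,f})` acts on ALL of `P` through `χ`

Topic `NumberTheory/Automorphic`; namespace `Literature.NumberTheory.Automorphic.UnitaryGroup` (declarations about a discrete automorphic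
representation under `DiscreteAutomorphicRep.…` for dot notation).  THEOREMS ONLY.  Setting = that of ★ `UnitaryGroupPlaceInclusion` ∕
★ `DiscreteAutomorphicRepFinSmoothVector`: `E/F` number fields, `c : E ≃ₐ[F] E`, `J ∈ M_N(E)`, the adelic unitary group datum
★ `adelicGroupData F E c N J`, an automorphic measure `μ`, a discrete automorphic representation `P` (an irreducible closed invariant subspace
of `L²(U(J)(F) A_G \ U(J)(𝔸_F), μ)`, ★ `DiscreteAutomorphicRep`), its restriction ★ `P.finRep` to `U(J)(𝔸_{F,f})` along ★ `finAdelicToAdelic`,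
and the smooth part ★ `P.finRep.smoothPart` (vectors with open stabiliser in `U(J)(𝔸_{F,f})`).

THE STATEMENT ([BorelJacquet1979] §4.6; [Flath1979] §2; the passage «local components ⇒ global» that every use of `π = ⊗′_v π_v` for a
ONE-DIMENSIONAL finite part makes silently).  Let `χ : U(J)(𝔸_F) →* ℂˣ` be a continuous character and suppose that at EVERY finite place
`v` of `F` the local group `U(J)(F_v)` (★ `localPi … v`, embedded by ★ `inclPlaceAdelic v`) acts on every `U(J)(𝔸_{F,f})`-smooth vector of
`P` through `χ`: `R(ι_v u) f = χ(ι_v u) • f` (hypothesis `hloc`, the shape of ★ `toContRep_inclPlaceAdelic_apply_eq_smul_of_realises₂` with the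
compactness guard removed).  Then `U(J)(𝔸_{F,f})` acts on EVERY vector of `P` through `χ`: `R(1, b) f = χ(1, b) • f` for all
`b ∈ U(J)(𝔸_{F,f})`, `f ∈ P` (**`DiscreteAutomorphicRep.toContRep_finAdelicToAdelic_apply_eq_smul_of_forall_inclPlaceAdelic`**).

PROOF.  §1 (restricted product) every `b ∈ U(J)(𝔸_{F,f}) ≅ ∏′_v U(J)(F_v)` (★ `finAdelicEquiv`) factors, modulo ANY neighbourhood `U` of
`1`, through finitely many places: `b = d · k` with `k ∈ U` and `d_v = 1` off a finite set `S` (★ `exists_finset_forall_mem_of_nhds_one`: `U`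
contains a cofinite box `∏_{v ∉ T} U(J)(𝒪_v) × ∏_{v ∈ T} {1}`; almost all `b_v` are integral).  §2 an element supported on a finite `S` is
a product of `inclPlace v (d_v)`, `v ∈ S` (★ `exists_eq_mul_inclPlace`, induction on `S`), so it acts on smooth vectors through `χ` by
`hloc` (smooth vectors are stable, ★ `Representation.smoothPart`).  §3 for a smooth `f` take `U = Stab(f) ∩ ker χ_f` (open: `f` smooth, ★
`isOpen_ker_comp_finAdelicToAdelic`): `R(b) f = R(d) R(k) f = R(d) f = χ(d) f = χ(b) f`.  §4 the smooth vectors are DENSE in `P` — for free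
from irreducibility: their closure is a closed subspace, non-zero (★ `DiscreteAutomorphicRep.finRep_smoothPart_ne_bot`, the Alaoglu–Birkhoff
fixed vector) and `U(J)(𝔸_F)`-stable (`g = g_∞ · g_f`, ★ `archToAdelic_mul_finAdelicToAdelic`; `g_f` preserves smoothness, and so does
`g_∞`, which commutes with `U(J)(𝔸_{F,f})`, ★ `commute_archToAdelic_finAdelicToAdelic`), hence all of `P` (★ `P.irreducible`).  §5 the set
`{f | R(b) f = χ(b) f}` is closed and contains a dense subspace.

CONSUMER (cell `hodgecm-mathlib`, crux H413 = `stmt-HodgeConjecture-24833`, line LH7, letter O8b `PKmultOneU2Shape` ⟸ (O8b♭) ISOTYPY «a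
discrete automorphic `P₂` of `U(Φ₂)` realising the character family `ξ_v ∘ inl` at every finite place is `((η ψ) ∘ det)`-scalar», ★
`F0P3cPKtupleU2LineUnique.pkMultOneU2Shape_of_isotypy`): with the per-place input «`U(Φ₂)(L⁺_v)` acts on `P₂^∞` through `((η ψ) ∘ det) ∘ ι_v`»
(★ `F0P3cPKtupleU2LocalIsotypyCompact` on compact subgroups; its `∀ g` upgrade by the cell's `G°`∕central-square route) this file yields the
`U(Φ₂)(𝔸_{L⁺,f})`-half of (O8b♭) on ALL of `P₂`; what then remains of (O8b♭) is the archimedean component (weak approximation for `U(Φ₂)(L⁺)`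
in `U(Φ₂)(L⁺ ⊗ ℝ)`).  HONEST LABEL: generic automorphic plumbing, proved; HC_CM is proved only modulo the 7 printed citations of that programme
(2 remaining: hLiu418 = stmt-HodgeConjecture-24832, h413 = stmt-HodgeConjecture-24833) until its rung 0 closes; this file books nothing and
discharges nothing booked.

## What is proved (generic `adelicGroupData F E c N J`, `[IsAutomorphicMeasure μ]`, `P : DiscreteAutomorphicRep …`)
* §1 `UnitaryGroup.exists_finset_eq_mul_of_mem_nhds_one` — `∀ U ∈ 𝓝 1, ∀ b, ∃ S d k, b = d * k ∧ k ∈ U ∧ ∀ v ∉ S, d_v = 1`.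
* §2 `DiscreteAutomorphicRep.toContRep_finAdelicToAdelic_apply_eq_smul_of_forall_evalPlace_eq_one` — under `hloc`, an element of
  `U(J)(𝔸_{F,f})` supported on a finite set of places acts on smooth vectors through `χ`.
* §3 `DiscreteAutomorphicRep.toContRep_finAdelicToAdelic_apply_eq_smul_of_mem_smoothPart` — under `hloc`, ALL of `U(J)(𝔸_{F,f})` acts on smooth
  vectors through `χ`; `…finRep_apply_eq_smul_of_mem_smoothPart` (the same for ★ `P.finRep`).
* §4 `DiscreteAutomorphicRep.toContRep_apply_mem_finRep_smoothPart` (the smooth part is `U(J)(𝔸_F)`-stable),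
  **`DiscreteAutomorphicRep.finRep_smoothPart_topologicalClosure_eq_top`**, `DiscreteAutomorphicRep.dense_finRep_smoothPart` (smooth vectors are dense).
* §5 **`DiscreteAutomorphicRep.toContRep_finAdelicToAdelic_apply_eq_smul_of_forall_inclPlaceAdelic`** (all vectors), `…finRep_apply_eq_smul_of_forall_inclPlaceAdelic`;
  `…_of_forall_inclPlace` — the same from the per-place input in the ★ `P.finRep.smoothPart ∘ inclPlace v` spelling.
* §6 `DiscreteAutomorphicRep.toContRep_apply_eq_smul_of_forall_inclPlaceAdelic_of_forall_archToAdelic` — with the archimedean input `harch` as a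
  binder, ALL of `U(J)(𝔸_F)` acts through `χ` (the `hiso` shape of the cell's O8b); `harch` is the honest residual.

## References
* [BorelJacquet1979] A. Borel, H. Jacquet, *Automorphic forms and automorphic representations*, Corvallis PSPM 33.1 (1979), §4.1, §4.6.
* [Flath1979] D. Flath, *Decomposition of representations into tensor products*, Corvallis PSPM 33.1 (1979), §2 (restricted tensor products).
* [TateThesis1967] J. Tate, thesis, in Cassels–Fröhlich (1967), Ch. XV §3.2 (cofinite boxes in restricted products).
* [BernsteinZelevinsky1976] I. N. Bernstein, A. V. Zelevinsky, Russian Math. Surveys 31:3 (1976), §2.1 (smooth vectors).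
-/

set_option autoImplicit false

noncomputable section

open MeasureTheory NumberField IsDedekindDomain Topology Filter
open scoped RestrictedProduct

namespace Literature.NumberTheory.Automorphic.UnitaryGroup

section Generic

variable {F E : Type} [Field F] [NumberField F] [Field E] [NumberField E] [Algebra F E]
  {c : E ≃ₐ[F] E} {N : ℕ} {J : Matrix (Fin N) (Fin N) E}

/-! ## §1 Factorisation of `U(J)(𝔸_{F,f})` modulo a neighbourhood of `1` through finitely many places -/

/-- **Finite support modulo a neighbourhood of `1`.**  For every neighbourhood `U` of `1` in `U(J)(𝔸_{F,f})` and every `b`, there are a finite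
set `S` of finite places of `F` and a factorisation `b = d · k` with `k ∈ U` and `d_v = 1` for all `v ∉ S` (★ `evalPlace`).  Under ★
`finAdelicEquiv : U(J)(𝔸_{F,f}) ≃ₜ* ∏′_v (U(J)(F_v) : U(J)(𝒪_v))`, `U` contains a cofinite box `∏_{v ∉ T} U(J)(𝒪_v) × ∏_{v ∈ T} {1}` (★
`exists_finset_forall_mem_of_nhds_one`, `U(J)(𝒪_v)` open ★ `isOpen_localInt`), and `b_v ∈ U(J)(𝒪_v)` off a finite set; `k` is `b` with the
coordinates in `S = T ∪ {v | b_v ∉ U(J)(𝒪_v)}` replaced by `1`. [cite: TateThesis1967, Ch. XV §3.2, proof of Lemma 3.2.1] [cite: BorelJacquet1979, §4.1] -/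
theorem exists_finset_eq_mul_of_mem_nhds_one {U : Set (finAdelic F E c N J)} (hU : U ∈ 𝓝 (1 : finAdelic F E c N J))
    (b : finAdelic F E c N J) :
    ∃ (S : Finset (HeightOneSpectrum (𝓞 F))) (d k : finAdelic F E c N J),
      b = d * k ∧ k ∈ U ∧ ∀ v ∉ S, evalPlace F E c N J v d = 1 := by
  classical
  -- transport `U` to the restricted product `∏′_v (U(J)(F_v) : U(J)(𝒪_v))`
  have hU' : (finAdelicEquiv F E c N J).symm ⁻¹' U ∈
      𝓝 (1 : Πʳ v : HeightOneSpectrum (𝓞 F), [localPi E c N J v, localInt E c N J v]) := by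
    refine (finAdelicEquiv F E c N J).symm.continuous.continuousAt.preimage_mem_nhds ?_
    change U ∈ 𝓝 ((finAdelicEquiv F E c N J).symm 1)
    rwa [map_one]
  obtain ⟨T, hT⟩ := Literature.Topology.Algebra.RestrictedProduct.exists_finset_forall_mem_of_nhds_one
    (B := fun v : HeightOneSpectrum (𝓞 F) => localInt E c N J v) (fun v => isOpen_localInt E c N J v) hU'
  -- the finitely many non-integral coordinates of `b`
  set γ : Πʳ v : HeightOneSpectrum (𝓞 F), [localPi E c N J v, localInt E c N J v] := finAdelicEquiv F E c N J b with hγdef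
  have hfin : {v : HeightOneSpectrum (𝓞 F) | γ v ∉ localInt E c N J v}.Finite := Filter.eventually_cofinite.mp γ.2
  let S : Finset (HeightOneSpectrum (𝓞 F)) := T ∪ hfin.toFinset
  -- `k'` = `γ` with the coordinates in `S` replaced by `1`
  have hk'int : ∀ v : HeightOneSpectrum (𝓞 F),
      (if v ∈ S then (1 : localPi E c N J v) else γ v) ∈ (localInt E c N J v : Set (localPi E c N J v)) := by
    intro v
    by_cases hv : v ∈ S
    · rw [if_pos hv]
      exact (localInt E c N J v).one_mem
    · rw [if_neg hv]
      by_contra hnot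
      exact hv (Finset.mem_union_right _ (hfin.mem_toFinset.mpr hnot))
  let k' : Πʳ v : HeightOneSpectrum (𝓞 F), [localPi E c N J v, localInt E c N J v] :=
    ⟨fun v => if v ∈ S then 1 else γ v, Filter.Eventually.of_forall hk'int⟩
  have hk'S : ∀ v ∈ S, k' v = 1 := fun v hv => by
    change (if v ∈ S then (1 : localPi E c N J v) else γ v) = 1
    rw [if_pos hv]
  have hk'nS : ∀ v ∉ S, k' v = γ v := fun v hv => by
    change (if v ∈ S then (1 : localPi E c N J v) else γ v) = γ v
    rw [if_neg hv]
  refine ⟨S, b * ((finAdelicEquiv F E c N J).symm k')⁻¹, (finAdelicEquiv F E c N J).symm k', ?_, ?_, fun v hv => ?_⟩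
  · rw [inv_mul_cancel_right]
  · exact hT k' hk'int fun v hv => hk'S v (Finset.mem_union_left _ hv)
  · rw [map_mul, map_inv]
    change γ v * ((finAdelicEquiv F E c N J ((finAdelicEquiv F E c N J).symm k')) v)⁻¹ = 1
    rw [ContinuousMulEquiv.apply_symm_apply, hk'nS v hv, mul_inv_cancel]

variable {μ : Measure (adelicGroupData F E c N J).automorphicQuotient} [(adelicGroupData F E c N J).IsAutomorphicMeasure μ]

/-! ## §2 Under the per-place hypothesis, finitely supported elements act on smooth vectors through `χ` -/

/-- **Finitely supported elements act through `χ` on smooth vectors.**  Suppose that at every finite place `v` the local group `U(J)(F_v)`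
(along ★ `inclPlaceAdelic v`) acts on every `U(J)(𝔸_{F,f})`-smooth vector of `P` through the character `χ` (`hloc`).  Then every
`d ∈ U(J)(𝔸_{F,f})` with `d_v = 1` off a finite set `S` acts on smooth vectors through `χ`: `d` is the product of its components
`inclPlace v (d_v)`, `v ∈ S` (★ `exists_eq_mul_inclPlace`, induction on `S`), and smooth vectors are stable (★ `Representation.smoothPart`).
[cite: BorelJacquet1979, §4.6] [cite: Flath1979, §2] -/
theorem _root_.Literature.NumberTheory.Automorphic.DiscreteAutomorphicRep.toContRep_finAdelicToAdelic_apply_eq_smul_of_forall_evalPlace_eq_one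
    (P : DiscreteAutomorphicRep (adelicGroupData F E c N J) μ) (χ : (adelicGroupData F E c N J).Adelic →* ℂˣ)
    (hloc : ∀ (v : HeightOneSpectrum (𝓞 F)) (u : localPi E c N J v) (f : P.space.toSubmodule), f ∈ P.finRep.smoothPart →
      P.space.toContRep (inclPlaceAdelic F E c N J v u) f = ((χ (inclPlaceAdelic F E c N J v u) : ℂˣ) : ℂ) • f)
    (S : Finset (HeightOneSpectrum (𝓞 F))) :
    ∀ d : finAdelic F E c N J, (∀ v ∉ S, evalPlace F E c N J v d = 1) →
      ∀ f : P.space.toSubmodule, f ∈ P.finRep.smoothPart →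
        P.space.toContRep (finAdelicToAdelic F E c N J d) f = ((χ (finAdelicToAdelic F E c N J d) : ℂˣ) : ℂ) • f := by
  classical
  induction S using Finset.induction_on with
  | empty =>
    intro d hd f _
    have h1 : d = 1 :=
      eq_of_forall_evalPlace_eq F E c N J fun v => by rw [hd v (Finset.notMem_empty v), map_one]
    subst h1
    rw [map_one, map_one, map_one, Units.val_one, one_smul, one_apply_eq_self]
  | insert a S ha ih =>
    intro d hd f hf
    obtain ⟨d', hd'a, hd'w, hdd'⟩ := exists_eq_mul_inclPlace F E c N J a d
    have hd' : ∀ v ∉ S, evalPlace F E c N J v d' = 1 := by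
      intro v hv
      by_cases hva : v = a
      · subst hva
        exact hd'a
      · rw [hd'w v hva]
        exact hd v (by simp only [Finset.mem_insert, hva, hv, or_self, not_false_eq_true])
    -- the component at `a` acts through `χ` by `hloc`
    have hB : P.space.toContRep (finAdelicToAdelic F E c N J (inclPlace F E c N J a (evalPlace F E c N J a d))) f =
        ((χ (finAdelicToAdelic F E c N J (inclPlace F E c N J a (evalPlace F E c N J a d))) : ℂˣ) : ℂ) • f :=
      hloc a (evalPlace F E c N J a d) f hf
    rw [hdd', (finAdelicToAdelic F E c N J).map_mul, map_mul P.space.toContRep, χ.map_mul, mul_apply_eq_comp, hB,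
      ContinuousLinearMap.map_smul_of_tower, ih d' hd' f hf, smul_smul, Units.val_mul, mul_comm]

/-! ## §3 Under the per-place hypothesis, all of `U(J)(𝔸_{F,f})` acts on smooth vectors through `χ` -/

/-- **`U(J)(𝔸_{F,f})` acts on SMOOTH vectors through `χ`.**  Under `hloc` and for a CONTINUOUS `χ`: for every `b ∈ U(J)(𝔸_{F,f})` and every
smooth `f ∈ P`, `R(1, b) f = χ(1, b) • f`.  Factor `b = d · k` modulo the open `Stab(f) ∩ ker χ|_{U(J)(𝔸_{F,f})}` (§1; ★
`isOpen_ker_comp_finAdelicToAdelic`): `R(b) f = R(d) R(k) f = R(d) f = χ(d) f = χ(d) χ(k) f = χ(b) f` (§2).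
[cite: BorelJacquet1979, §4.6] [cite: Flath1979, §2] -/
theorem _root_.Literature.NumberTheory.Automorphic.DiscreteAutomorphicRep.toContRep_finAdelicToAdelic_apply_eq_smul_of_mem_smoothPart
    (P : DiscreteAutomorphicRep (adelicGroupData F E c N J) μ) (χ : (adelicGroupData F E c N J).Adelic →* ℂˣ)
    (hχ : Continuous fun g => ((χ g : ℂˣ) : ℂ))
    (hloc : ∀ (v : HeightOneSpectrum (𝓞 F)) (u : localPi E c N J v) (f : P.space.toSubmodule), f ∈ P.finRep.smoothPart →
      P.space.toContRep (inclPlaceAdelic F E c N J v u) f = ((χ (inclPlaceAdelic F E c N J v u) : ℂˣ) : ℂ) • f)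
    (b : finAdelic F E c N J) (f : P.space.toSubmodule) (hf : f ∈ P.finRep.smoothPart) :
    P.space.toContRep (finAdelicToAdelic F E c N J b) f = ((χ (finAdelicToAdelic F E c N J b) : ℂˣ) : ℂ) • f := by
  have hfo : IsOpen (P.finRep.stabilizerSubgroup f : Set (finAdelic F E c N J)) := hf
  have hU : ((P.finRep.stabilizerSubgroup f : Set (finAdelic F E c N J)) ∩
        (((χ.comp (finAdelicToAdelic F E c N J)).ker : Subgroup (finAdelic F E c N J)) : Set (finAdelic F E c N J))) ∈
      𝓝 (1 : finAdelic F E c N J) :=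
    (hfo.inter (isOpen_ker_comp_finAdelicToAdelic χ hχ)).mem_nhds
      ⟨(P.finRep.stabilizerSubgroup f).one_mem, (χ.comp (finAdelicToAdelic F E c N J)).ker.one_mem⟩
  obtain ⟨S, d, k, hb, ⟨hkf, hkχ⟩, hd⟩ := exists_finset_eq_mul_of_mem_nhds_one hU b
  have hkf' : P.space.toContRep (finAdelicToAdelic F E c N J k) f = f := hkf
  have hkχ' : χ (finAdelicToAdelic F E c N J k) = 1 := hkχ
  rw [hb, (finAdelicToAdelic F E c N J).map_mul, map_mul P.space.toContRep, χ.map_mul, mul_apply_eq_comp, hkf', hkχ', mul_one]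
  exact P.toContRep_finAdelicToAdelic_apply_eq_smul_of_forall_evalPlace_eq_one χ hloc S d hd f hf

/-- **The same for ★ `P.finRep`** (`P.finRep b f = R(1, b) f`, `rfl`): under `hloc`, `P.finRep b f = χ(1, b) • f` for every smooth `f`.
[cite: BorelJacquet1979, §4.6] -/
theorem _root_.Literature.NumberTheory.Automorphic.DiscreteAutomorphicRep.finRep_apply_eq_smul_of_mem_smoothPart
    (P : DiscreteAutomorphicRep (adelicGroupData F E c N J) μ) (χ : (adelicGroupData F E c N J).Adelic →* ℂˣ)
    (hχ : Continuous fun g => ((χ g : ℂˣ) : ℂ))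
    (hloc : ∀ (v : HeightOneSpectrum (𝓞 F)) (u : localPi E c N J v) (f : P.space.toSubmodule), f ∈ P.finRep.smoothPart →
      P.space.toContRep (inclPlaceAdelic F E c N J v u) f = ((χ (inclPlaceAdelic F E c N J v u) : ℂˣ) : ℂ) • f)
    (b : finAdelic F E c N J) (f : P.space.toSubmodule) (hf : f ∈ P.finRep.smoothPart) :
    P.finRep b f = ((χ (finAdelicToAdelic F E c N J b) : ℂˣ) : ℂ) • f :=
  P.toContRep_finAdelicToAdelic_apply_eq_smul_of_mem_smoothPart χ hχ hloc b f hf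

/-! ## §4 The smooth vectors for `U(J)(𝔸_{F,f})` are `U(J)(𝔸_F)`-stable and DENSE in `P` -/

/-- **The `U(J)(𝔸_{F,f})`-smooth vectors of `P` are stable under all of `U(J)(𝔸_F)`.**  Write `g = g_∞ · g_f` (★ `archToAdelic_mul_finAdelicToAdelic`);
`R(g_f)` preserves smoothness (★ `Representation.smoothPart` is a subrepresentation of ★ `P.finRep`), and `R(g_∞)` commutes with `R(U(J)(𝔸_{F,f}))`
(★ `commute_archToAdelic_finAdelicToAdelic`), so the stabiliser of `R(g_∞) f′` contains that of `f′`. [cite: BorelJacquet1979, §4.1, §4.6]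
[cite: BernsteinZelevinsky1976, §2.1] -/
theorem _root_.Literature.NumberTheory.Automorphic.DiscreteAutomorphicRep.toContRep_apply_mem_finRep_smoothPart
    (P : DiscreteAutomorphicRep (adelicGroupData F E c N J) μ) (g : (adelicGroupData F E c N J).Adelic)
    {f : P.space.toSubmodule} (hf : f ∈ P.finRep.smoothPart) :
    P.space.toContRep g f ∈ P.finRep.smoothPart := by
  rw [← archToAdelic_mul_finAdelicToAdelic F E c N J g, map_mul, mul_apply_eq_comp]
  -- the finite part preserves smoothness
  have h1 : P.space.toContRep (finAdelicToAdelic F E c N J (finPart F E c N J g)) f ∈ P.finRep.smoothPart :=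
    P.finRep.smoothPart.apply_mem_toSubmodule (finPart F E c N J g) hf
  set f' : P.space.toSubmodule := P.space.toContRep (finAdelicToAdelic F E c N J (finPart F E c N J g)) f with hf'def
  have hf'o : IsOpen (P.finRep.stabilizerSubgroup f' : Set (finAdelic F E c N J)) := h1
  -- the archimedean part commutes with `U(J)(𝔸_{F,f})`
  refine P.finRep.isSmoothVector_of_le hf'o fun k hk => ?_
  rw [Representation.mem_stabilizerSubgroup] at hk ⊢
  have hk' : P.space.toContRep (finAdelicToAdelic F E c N J k) f' = f' := hk
  change P.space.toContRep (finAdelicToAdelic F E c N J k)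
      (P.space.toContRep (archToAdelic F E c N J (archPart F E c N J g)) f') =
    P.space.toContRep (archToAdelic F E c N J (archPart F E c N J g)) f'
  rw [← mul_apply_eq_comp, ← map_mul, ← (commute_archToAdelic_finAdelicToAdelic F E c N J _ k).eq, map_mul,
    mul_apply_eq_comp, hk']

/-- **The `U(J)(𝔸_{F,f})`-smooth vectors are DENSE in `P`: their closure is all of `P`** — for free from irreducibility: the closure of the smooth
part is a CLOSED `U(J)(𝔸_F)`-stable subspace (`toContRep_apply_mem_finRep_smoothPart` and continuity of each `R(g)`), NON-ZERO (★
`DiscreteAutomorphicRep.finRep_smoothPart_ne_bot`: an Alaoglu–Birkhoff fixed vector), hence everything (★ `P.irreducible`).  No Haar averaging is used.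
[cite: BorelJacquet1979, §4.6] [cite: BernsteinZelevinsky1976, §2.1] -/
theorem _root_.Literature.NumberTheory.Automorphic.DiscreteAutomorphicRep.finRep_smoothPart_topologicalClosure_eq_top
    (P : DiscreteAutomorphicRep (adelicGroupData F E c N J) μ) :
    P.finRep.smoothPart.toSubmodule.topologicalClosure = ⊤ := by
  -- the closure of the smooth part, as a closed subrepresentation of `P`
  let W : ContRepresentation.ClosedSubrep P.space.toContRep :=
    { toSubmodule := P.finRep.smoothPart.toSubmodule.topologicalClosure
      apply_mem_toSubmodule := fun g v hv => by
        have hmaps : Set.MapsTo (P.space.toContRep g) (P.finRep.smoothPart.toSubmodule : Set P.space.toSubmodule)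
            (P.finRep.smoothPart.toSubmodule : Set P.space.toSubmodule) :=
          fun x hx => P.toContRep_apply_mem_finRep_smoothPart g hx
        have hcl := hmaps.closure (P.space.toContRep g).continuous
        rw [← Submodule.topologicalClosure_coe] at hcl
        exact hcl hv
      isClosed' := Submodule.isClosed_topologicalClosure _ }
  rcases ((ContRepresentation.isTopIrreducible_iff _).mp P.irreducible).2 W with hW | hW
  · exfalso
    refine P.finRep_smoothPart_ne_bot (eq_bot_iff.mpr fun x hx => ?_)
    have hxW : x ∈ W := P.finRep.smoothPart.toSubmodule.le_topologicalClosure hx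
    rw [hW, ContRepresentation.ClosedSubrep.mem_bot] at hxW
    rw [hxW]
    exact Submodule.zero_mem _
  · have h : W.toSubmodule = (⊤ : ContRepresentation.ClosedSubrep P.space.toContRep).toSubmodule := by rw [hW]
    rw [ContRepresentation.ClosedSubrep.toSubmodule_top] at h
    exact h

/-- **The `U(J)(𝔸_{F,f})`-smooth vectors are dense in `P`** (`Dense` form of `finRep_smoothPart_topologicalClosure_eq_top`).
[cite: BorelJacquet1979, §4.6] [cite: BernsteinZelevinsky1976, §2.1] -/
theorem _root_.Literature.NumberTheory.Automorphic.DiscreteAutomorphicRep.dense_finRep_smoothPart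
    (P : DiscreteAutomorphicRep (adelicGroupData F E c N J) μ) :
    Dense (P.finRep.smoothPart.toSubmodule : Set P.space.toSubmodule) :=
  Submodule.dense_iff_topologicalClosure_eq_top.mpr P.finRep_smoothPart_topologicalClosure_eq_top

/-! ## §5 Under the per-place hypothesis, `U(J)(𝔸_{F,f})` acts on ALL of `P` through `χ` -/

/-- **FROM THE PLACES TO THE FINITE ADÈLES, ON ALL OF `P`.**  Let `χ : U(J)(𝔸_F) →* ℂˣ` be continuous and suppose that at every finite place `v`
the local group `U(J)(F_v)` (along ★ `inclPlaceAdelic v`) acts on every `U(J)(𝔸_{F,f})`-smooth vector of the discrete automorphic `P` through `χ`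
(`hloc`).  Then for EVERY `b ∈ U(J)(𝔸_{F,f})` and EVERY `f ∈ P`: `R(1, b) f = χ(1, b) • f` — the set of such `f` is closed (continuity of `R(1, b)`)
and contains the dense smooth part (§3, §4). [cite: BorelJacquet1979, §4.6] [cite: Flath1979, §2] -/
theorem _root_.Literature.NumberTheory.Automorphic.DiscreteAutomorphicRep.toContRep_finAdelicToAdelic_apply_eq_smul_of_forall_inclPlaceAdelic
    (P : DiscreteAutomorphicRep (adelicGroupData F E c N J) μ) (χ : (adelicGroupData F E c N J).Adelic →* ℂˣ)
    (hχ : Continuous fun g => ((χ g : ℂˣ) : ℂ))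
    (hloc : ∀ (v : HeightOneSpectrum (𝓞 F)) (u : localPi E c N J v) (f : P.space.toSubmodule), f ∈ P.finRep.smoothPart →
      P.space.toContRep (inclPlaceAdelic F E c N J v u) f = ((χ (inclPlaceAdelic F E c N J v u) : ℂˣ) : ℂ) • f)
    (b : finAdelic F E c N J) (f : P.space.toSubmodule) :
    P.space.toContRep (finAdelicToAdelic F E c N J b) f = ((χ (finAdelicToAdelic F E c N J b) : ℂˣ) : ℂ) • f := by
  have hclosed : IsClosed {f : P.space.toSubmodule |
      P.space.toContRep (finAdelicToAdelic F E c N J b) f = ((χ (finAdelicToAdelic F E c N J b) : ℂˣ) : ℂ) • f} :=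
    isClosed_eq (P.space.toContRep _).continuous (continuous_const_smul _)
  have hsub : (P.finRep.smoothPart.toSubmodule : Set P.space.toSubmodule) ⊆ {f : P.space.toSubmodule |
      P.space.toContRep (finAdelicToAdelic F E c N J b) f = ((χ (finAdelicToAdelic F E c N J b) : ℂˣ) : ℂ) • f} :=
    fun f hf => P.toContRep_finAdelicToAdelic_apply_eq_smul_of_mem_smoothPart χ hχ hloc b f hf
  have hdense : Dense {f : P.space.toSubmodule |
      P.space.toContRep (finAdelicToAdelic F E c N J b) f = ((χ (finAdelicToAdelic F E c N J b) : ℂˣ) : ℂ) • f} :=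
    P.dense_finRep_smoothPart.mono hsub
  have huniv : {f : P.space.toSubmodule |
      P.space.toContRep (finAdelicToAdelic F E c N J b) f = ((χ (finAdelicToAdelic F E c N J b) : ℂˣ) : ℂ) • f} = Set.univ := by
    rw [← hclosed.closure_eq, hdense.closure_eq]
  exact (Set.eq_univ_iff_forall.mp huniv) f

/-- **The same for ★ `P.finRep`**: under `hloc`, `P.finRep b f = χ(1, b) • f` for EVERY `f ∈ P` — the finite part of `P` is the character
`χ ∘ finAdelicToAdelic`. [cite: BorelJacquet1979, §4.6] [cite: Flath1979, §2] -/
theorem _root_.Literature.NumberTheory.Automorphic.DiscreteAutomorphicRep.finRep_apply_eq_smul_of_forall_inclPlaceAdelic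
    (P : DiscreteAutomorphicRep (adelicGroupData F E c N J) μ) (χ : (adelicGroupData F E c N J).Adelic →* ℂˣ)
    (hχ : Continuous fun g => ((χ g : ℂˣ) : ℂ))
    (hloc : ∀ (v : HeightOneSpectrum (𝓞 F)) (u : localPi E c N J v) (f : P.space.toSubmodule), f ∈ P.finRep.smoothPart →
      P.space.toContRep (inclPlaceAdelic F E c N J v u) f = ((χ (inclPlaceAdelic F E c N J v u) : ℂˣ) : ℂ) • f)
    (b : finAdelic F E c N J) (f : P.space.toSubmodule) :
    P.finRep b f = ((χ (finAdelicToAdelic F E c N J b) : ℂˣ) : ℂ) • f :=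
  P.toContRep_finAdelicToAdelic_apply_eq_smul_of_forall_inclPlaceAdelic χ hχ hloc b f

/-- **The per-place input in the `P.finRep.smoothPart ∘ inclPlace v` spelling** (the shape of ★ `finRep_smoothPart_inclPlace_apply_eq_smul_of_realises₂`
with the compactness guard removed): if for every `v`, every `u ∈ U(J)(F_v)` and every smooth `f`,
`(P.finRep.smoothPart ∘ inclPlace v) u f = χ(ι_v u) • f`, then `R(1, b) f = χ(1, b) • f` for EVERY `b ∈ U(J)(𝔸_{F,f})` and EVERY `f ∈ P`.
[cite: BorelJacquet1979, §4.6] [cite: Flath1979, §2] -/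
theorem _root_.Literature.NumberTheory.Automorphic.DiscreteAutomorphicRep.toContRep_finAdelicToAdelic_apply_eq_smul_of_forall_inclPlace
    (P : DiscreteAutomorphicRep (adelicGroupData F E c N J) μ) (χ : (adelicGroupData F E c N J).Adelic →* ℂˣ)
    (hχ : Continuous fun g => ((χ g : ℂˣ) : ℂ))
    (hloc' : ∀ (v : HeightOneSpectrum (𝓞 F)) (u : localPi E c N J v) (f : ↥P.finRep.smoothPart.toSubmodule),
      P.finRep.smoothPart.toRepresentation (inclPlace F E c N J v u) f =
        ((χ (inclPlaceAdelic F E c N J v u) : ℂˣ) : ℂ) • f)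
    (b : finAdelic F E c N J) (f : P.space.toSubmodule) :
    P.space.toContRep (finAdelicToAdelic F E c N J b) f = ((χ (finAdelicToAdelic F E c N J b) : ℂˣ) : ℂ) • f :=
  P.toContRep_finAdelicToAdelic_apply_eq_smul_of_forall_inclPlaceAdelic χ hχ
    (fun v u f hf => congrArg Subtype.val (hloc' v u ⟨f, hf⟩)) b f

/-! ## §6 What remains for all of `U(J)(𝔸_F)`: the archimedean component -/

/-- **Reduction of «`U(J)(𝔸_F)` acts on `P` through `χ`» to the archimedean component.**  Under `hloc` (every finite place) and `harch` (the
archimedean group `U(J)(E ⊗ ℝ)`, along ★ `archToAdelic`, acts on `P` through `χ`), ALL of `U(J)(𝔸_F)` acts on `P` through `χ`: `g = g_∞ · g_f` (★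
`archToAdelic_mul_finAdelicToAdelic`) and §5.  This is the exact shape of the ISOTYPY hypothesis `hiso` of the cell's ★
`F0P3cPKtupleU2LineUnique.pkMultOneU2Shape_of_isotypy`; `harch` names what is then left (in print: weak approximation for `U(J)(F)` in `U(J)(F ⊗ ℝ)`).
[cite: BorelJacquet1979, §4.1, §4.6] -/
theorem _root_.Literature.NumberTheory.Automorphic.DiscreteAutomorphicRep.toContRep_apply_eq_smul_of_forall_inclPlaceAdelic_of_forall_archToAdelic
    (P : DiscreteAutomorphicRep (adelicGroupData F E c N J) μ) (χ : (adelicGroupData F E c N J).Adelic →* ℂˣ)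
    (hχ : Continuous fun g => ((χ g : ℂˣ) : ℂ))
    (hloc : ∀ (v : HeightOneSpectrum (𝓞 F)) (u : localPi E c N J v) (f : P.space.toSubmodule), f ∈ P.finRep.smoothPart →
      P.space.toContRep (inclPlaceAdelic F E c N J v u) f = ((χ (inclPlaceAdelic F E c N J v u) : ℂˣ) : ℂ) • f)
    (harch : ∀ (a : arch F E c N J) (f : P.space.toSubmodule),
      P.space.toContRep (archToAdelic F E c N J a) f = ((χ (archToAdelic F E c N J a) : ℂˣ) : ℂ) • f)
    (g : (adelicGroupData F E c N J).Adelic) (f : P.space.toSubmodule) :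
    P.space.toContRep g f = ((χ g : ℂˣ) : ℂ) • f := by
  rw [← archToAdelic_mul_finAdelicToAdelic F E c N J g, map_mul, χ.map_mul, mul_apply_eq_comp,
    P.toContRep_finAdelicToAdelic_apply_eq_smul_of_forall_inclPlaceAdelic χ hχ hloc, ContinuousLinearMap.map_smul_of_tower, harch,
    smul_smul, Units.val_mul, mul_comm]

end Generic

end Literature.NumberTheory.Automorphic.UnitaryGroup

end
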